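import Mathlib
import Summits.NavierStokesRegularity.NavierStokesRegularity.Theorems.FilamentSkeletonRssDefectColumnGateSectional2D

/-!
# Route `FilamentSkeletonRss` · crux `TransverseReduction1AG` (stmt-NavierStokesRegularity-27853) · line `defect_column_gate_1AG` —
# SEPARABLE STREAM FUNCTIONS `Ψ(y) = F(y₀)G(y₁)`: coordinate calculus and the S2a operator in closed form

Helper file (`--supports stmt-NavierStokesRegularity-27853 --as helper`; LEAD of 27853, lane ns-filament-21221-p1 g10).  Test-function calculus for the
sectional operator of the line (stub S2a-loc `WaistColumnGateLoc1A`) and the first third of the owed construction `FarFieldQuasimodes1A`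
(`Theorems/…WaistQuasimodes.lean`, which turns the superseded stub `WaistColumnGate1A` into a kernel-checked falsity): for separable stream functions
the whole S2a operator is an explicit scalar expression in `F, G` and their first four derivatives (memo S2A-FALSE-FARFIELD-27853-g10.md §9, term grouping).
HONEST FRAMING: calculus about the MODEL operator of a HYPOTHETICAL filament-type rotating-self-similar blow-up route (MODEL rung, negative side); no stub is
proved or refuted here; nothing here bears on Navier–Stokes regularity.

* `hasFDerivAt_sep`, `fderiv_sep_apply`, `contDiff_sep` — `D(F(y₀)G(y₁))[v] = F′G v₀ + FG′ v₁`;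
* `gradient_sep` — `∇(F(y₀)G(y₁)) = F′G e₀ + FG′ e₁`; `fderiv_sep_axis` — axial constancy;
* `laplacian_sep` — `Δ(F(y₀)G(y₁)) = F″G + FG″`;
* **`colForceVort_sep`** — for `B` diagonal in `(e₀,e₁,e₂)` with entries `(b₁,b₂,κ)`, `α = 0`, solenoidal base: `colForceVort B 0 gam Rc e₃ (∇Ψ × e₃)` equals
  `[ (κ−3/2)(F″G+FG″) − b₁y₀(F‴G+F′G″) − b₂y₁(F″G′+FG‴) + (F⁗G + 2F″G″ + FG⁗) + cφ(q)·(y₁(F‴G+F′G″) − y₀(F″G′+FG‴)) − (gam/2)ζ·(y₀FG′ − y₁F′G) ]·e₃`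
  (`c = gam·Rc/8π`, `φ = burgersPhi`, `q = gam(y₀²+y₁²)/4`, `ζ = (gam Rc/4π)e^{−q}`).
-/

set_option linter.dupNamespace false

noncomputable section

namespace Summit.NavierStokesRegularity.NavierStokesRegularity.Theorems.DefectColumnGate

open scoped BigOperators Topology InnerProductSpace Laplacian ContDiff
open Set Function
open Literature.Analysis.FluidPDE
open Summit.NavierStokesRegularity.NavierStokesRegularity.Theorems.KelvinGate

/-! ## 1. First derivatives of a separable scalar -/

/-- `D(F(y₀)G(y₁))(y) = F′(y₀)G(y₁)·pr₀ + F(y₀)G′(y₁)·pr₁`. -/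
theorem hasFDerivAt_sep {F G : ℝ → ℝ} {F' G' : ℝ} {y : EuclideanSpace ℝ (Fin 3)} (hF : HasDerivAt F F' (y 0)) (hG : HasDerivAt G G' (y 1)) :
    HasFDerivAt (fun y : EuclideanSpace ℝ (Fin 3) => F (y 0) * G (y 1))
      ((F' * G (y 1)) • (EuclideanSpace.proj (0 : Fin 3) : EuclideanSpace ℝ (Fin 3) →L[ℝ] ℝ) +
        (F (y 0) * G') • (EuclideanSpace.proj (1 : Fin 3) : EuclideanSpace ℝ (Fin 3) →L[ℝ] ℝ)) y := by
  have h0 := hF.comp_hasFDerivAt y ((EuclideanSpace.proj (𝕜 := ℝ) (0 : Fin 3)).hasFDerivAt (x := y))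
  have h1 := hG.comp_hasFDerivAt y ((EuclideanSpace.proj (𝕜 := ℝ) (1 : Fin 3)).hasFDerivAt (x := y))
  have h := h0.mul h1
  refine h.congr_fderiv ?_
  have hp : ∀ (i : Fin 3) (z : EuclideanSpace ℝ (Fin 3)), (EuclideanSpace.proj i : EuclideanSpace ℝ (Fin 3) →L[ℝ] ℝ) z = z i :=
    fun _ _ => rfl
  ext v
  simp only [_root_.add_apply, _root_.smul_apply, smul_eq_mul, Function.comp_apply, hp]
  ring

/-- Applied form: `D(F(y₀)G(y₁))(y)[v] = F′(y₀)G(y₁)v₀ + F(y₀)G′(y₁)v₁`. -/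
theorem fderiv_sep_apply {F G : ℝ → ℝ} {F' G' : ℝ} {y : EuclideanSpace ℝ (Fin 3)} (hF : HasDerivAt F F' (y 0)) (hG : HasDerivAt G G' (y 1))
    (v : EuclideanSpace ℝ (Fin 3)) :
    fderiv ℝ (fun y : EuclideanSpace ℝ (Fin 3) => F (y 0) * G (y 1)) y v = F' * G (y 1) * v 0 + F (y 0) * G' * v 1 := by
  rw [(hasFDerivAt_sep hF hG).fderiv]
  simp only [_root_.add_apply, _root_.smul_apply, smul_eq_mul]
  rfl

/-- `F(y₀)G(y₁) ∈ Cⁿ` for `F, G ∈ Cⁿ`. -/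
theorem contDiff_sep {F G : ℝ → ℝ} {n : WithTop ℕ∞} (hF : ContDiff ℝ n F) (hG : ContDiff ℝ n G) :
    ContDiff ℝ n (fun y : EuclideanSpace ℝ (Fin 3) => F (y 0) * G (y 1)) :=
  (hF.comp (EuclideanSpace.proj (𝕜 := ℝ) (0 : Fin 3)).contDiff).mul (hG.comp (EuclideanSpace.proj (𝕜 := ℝ) (1 : Fin 3)).contDiff)

/-- Axial constancy: `D(F(y₀)G(y₁))(y)[e₃] = 0`. -/
theorem fderiv_sep_axis {F G : ℝ → ℝ} (hF : Differentiable ℝ F) (hG : Differentiable ℝ G) (y : EuclideanSpace ℝ (Fin 3)) :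
    fderiv ℝ (fun y : EuclideanSpace ℝ (Fin 3) => F (y 0) * G (y 1)) y (EuclideanSpace.single 2 1) = 0 := by
  rw [fderiv_sep_apply (hF (y 0)).hasDerivAt (hG (y 1)).hasDerivAt]
  simp

/-- The gradient: `∇(F(y₀)G(y₁))(y) = F′(y₀)G(y₁) e₀ + F(y₀)G′(y₁) e₁`. -/
theorem gradient_sep {F G : ℝ → ℝ} {F' G' : ℝ} {y : EuclideanSpace ℝ (Fin 3)} (hF : HasDerivAt F F' (y 0)) (hG : HasDerivAt G G' (y 1)) :
    gradient (fun y : EuclideanSpace ℝ (Fin 3) => F (y 0) * G (y 1)) y =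
      (F' * G (y 1)) • EuclideanSpace.single 0 1 + (F (y 0) * G') • EuclideanSpace.single 1 1 := by
  refine ext_inner_right ℝ fun v => ?_
  rw [Literature.Analysis.FluidPDE.inner_gradient_left, fderiv_sep_apply hF hG v, inner_add_left, real_inner_smul_left, real_inner_smul_left,
    EuclideanSpace.inner_single_left, EuclideanSpace.inner_single_left]
  simp

/-! ## 2. The Laplacian of a separable scalar -/

/-- `Δ(F(y₀)G(y₁))(y) = F″(y₀)G(y₁) + F(y₀)G″(y₁)` for `F, G ∈ C²`. -/
theorem laplacian_sep {F G : ℝ → ℝ} (hF : ContDiff ℝ 2 F) (hG : ContDiff ℝ 2 G) (y : EuclideanSpace ℝ (Fin 3)) :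
    (Δ (fun y : EuclideanSpace ℝ (Fin 3) => F (y 0) * G (y 1))) y = deriv (deriv F) (y 0) * G (y 1) + F (y 0) * deriv (deriv G) (y 1) := by
  have hF1 : Differentiable ℝ F := hF.differentiable (by norm_num)
  have hG1 : Differentiable ℝ G := hG.differentiable (by norm_num)
  have hdF : ContDiff ℝ 1 (deriv F) := by
    have := hF.iterate_deriv' 1 1; simpa using this
  have hdG : ContDiff ℝ 1 (deriv G) := by
    have := hG.iterate_deriv' 1 1; simpa using this
  have hdF1 : Differentiable ℝ (deriv F) := hdF.differentiable (by norm_num)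
  have hdG1 : Differentiable ℝ (deriv G) := hdG.differentiable (by norm_num)
  -- the first derivative as a function
  set P0 : EuclideanSpace ℝ (Fin 3) →L[ℝ] ℝ := EuclideanSpace.proj (0 : Fin 3) with hP0
  set P1 : EuclideanSpace ℝ (Fin 3) →L[ℝ] ℝ := EuclideanSpace.proj (1 : Fin 3) with hP1
  have hD1 : fderiv ℝ (fun y : EuclideanSpace ℝ (Fin 3) => F (y 0) * G (y 1)) =
      fun y => (deriv F (y 0) * G (y 1)) • P0 + (F (y 0) * deriv G (y 1)) • P1 :=
    funext fun z => (hasFDerivAt_sep (hF1 (z 0)).hasDerivAt (hG1 (z 1)).hasDerivAt).fderiv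
  -- the second derivative at `y`
  have ha : HasFDerivAt (fun y : EuclideanSpace ℝ (Fin 3) => deriv F (y 0) * G (y 1))
      ((deriv (deriv F) (y 0) * G (y 1)) • P0 + (deriv F (y 0) * deriv G (y 1)) • P1) y :=
    hasFDerivAt_sep (hdF1 (y 0)).hasDerivAt (hG1 (y 1)).hasDerivAt
  have hb : HasFDerivAt (fun y : EuclideanSpace ℝ (Fin 3) => F (y 0) * deriv G (y 1))
      ((deriv F (y 0) * deriv G (y 1)) • P0 + (F (y 0) * deriv (deriv G) (y 1)) • P1) y :=
    hasFDerivAt_sep (hF1 (y 0)).hasDerivAt (hdG1 (y 1)).hasDerivAt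
  have hD2 : HasFDerivAt (fderiv ℝ (fun y : EuclideanSpace ℝ (Fin 3) => F (y 0) * G (y 1)))
      (((deriv (deriv F) (y 0) * G (y 1)) • P0 + (deriv F (y 0) * deriv G (y 1)) • P1).smulRight P0 +
        ((deriv F (y 0) * deriv G (y 1)) • P0 + (F (y 0) * deriv (deriv G) (y 1)) • P1).smulRight P1) y := by
    rw [hD1]
    exact (ha.smul_const P0).add (hb.smul_const P1)
  rw [KelvinGate.laplacian_eq_sum_fderiv_fderiv]
  simp only
  rw [hD2.fderiv]
  simp [Fin.sum_univ_three, hP0, hP1, ContinuousLinearMap.smulRight_apply]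

/-! ## 3. The S2a operator on a separable stream function -/

/-- A frame gradient diagonal in the standard frame. -/
theorem apply_of_diag {B : EuclideanSpace ℝ (Fin 3) →L[ℝ] EuclideanSpace ℝ (Fin 3)} {b₁ b₂ κ : ℝ}
    (hB0 : B (EuclideanSpace.single 0 1) = b₁ • EuclideanSpace.single 0 1) (hB1 : B (EuclideanSpace.single 1 1) = b₂ • EuclideanSpace.single 1 1)
    (hB2 : B (EuclideanSpace.single 2 1) = κ • EuclideanSpace.single 2 1) (y : EuclideanSpace ℝ (Fin 3)) :
    B y = (b₁ * y 0) • EuclideanSpace.single 0 1 + (b₂ * y 1) • EuclideanSpace.single 1 1 + (κ * y 2) • EuclideanSpace.single 2 1 := by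
  have hy : y = ∑ j, y j • EuclideanSpace.single j (1 : ℝ) := by
    conv_lhs => rw [← (EuclideanSpace.basisFun (Fin 3) ℝ).sum_repr y]
    simp
  conv_lhs => rw [hy]
  simp only [Fin.sum_univ_three, map_add, map_smul, hB0, hB1, hB2, smul_smul, mul_comm]

/-- A diagonal frame gradient has no axial vector: `curlCLM B = 0`. -/
theorem curlCLM_of_diag {B : EuclideanSpace ℝ (Fin 3) →L[ℝ] EuclideanSpace ℝ (Fin 3)} {b₁ b₂ κ : ℝ}
    (hB0 : B (EuclideanSpace.single 0 1) = b₁ • EuclideanSpace.single 0 1) (hB1 : B (EuclideanSpace.single 1 1) = b₂ • EuclideanSpace.single 1 1)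
    (hB2 : B (EuclideanSpace.single 2 1) = κ • EuclideanSpace.single 2 1) :
    curlCLM B = 0 := by
  rw [curlCLM_apply]
  ext i
  fin_cases i <;> simp [hB0, hB1, hB2]

/-- **THE S2a OPERATOR ON A SEPARABLE STREAM FUNCTION, IN CLOSED FORM.**  Let `F, G ∈ C⁴(ℝ)`, `Ψ(y) = F(y₀)G(y₁)`, `W = ∇Ψ × e₃`, and let the frame
gradient be diagonal, `B = diag(b₁, b₂, κ)` in `(e₀, e₁, e₂)`, with the base `colBase B 0 gam Rc e₃` solenoidal.  Then (all functions of `y₀` resp. `y₁`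
evaluated at `y₀` resp. `y₁`; `c = gam·Rc/(8π)`, `q = gam(|y|² − y₂²)/4`, `ζ = (gam·Rc/4π)e^{−q}`):
`colForceVort B 0 gam Rc e₃ W (y) = [ (κ − 3/2)(F″G + FG″) − b₁y₀(F‴G + F′G″) − b₂y₁(F″G′ + FG‴) + (F⁗G + 2F″G″ + FG⁗)
   + c·φ(q)·(y₁(F‴G + F′G″) − y₀(F″G′ + FG‴)) − (gam/2)·ζ·(y₀FG′ − y₁F′G) ]·e₃`. -/
theorem colForceVort_sep {F G : ℝ → ℝ} (hF : ContDiff ℝ 4 F) (hG : ContDiff ℝ 4 G)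
    {B : EuclideanSpace ℝ (Fin 3) →L[ℝ] EuclideanSpace ℝ (Fin 3)} {b₁ b₂ κ gam Rc : ℝ}
    (hB0 : B (EuclideanSpace.single 0 1) = b₁ • EuclideanSpace.single 0 1) (hB1 : B (EuclideanSpace.single 1 1) = b₂ • EuclideanSpace.single 1 1)
    (hB2 : B (EuclideanSpace.single 2 1) = κ • EuclideanSpace.single 2 1)
    (hdivU : VectorCalculus.IsDivFree (colBase B 0 gam Rc (EuclideanSpace.single 2 1))) (y : EuclideanSpace ℝ (Fin 3)) :
    colForceVort B 0 gam Rc (EuclideanSpace.single 2 1)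
        (fun z => cross (gradient (fun y : EuclideanSpace ℝ (Fin 3) => F (y 0) * G (y 1)) z) (EuclideanSpace.single 2 1)) y =
      ( (κ - 3/2) * (deriv (deriv F) (y 0) * G (y 1) + F (y 0) * deriv (deriv G) (y 1))
        - b₁ * y 0 * (deriv^[3] F (y 0) * G (y 1) + deriv F (y 0) * deriv (deriv G) (y 1))
        - b₂ * y 1 * (deriv (deriv F) (y 0) * deriv G (y 1) + F (y 0) * deriv^[3] G (y 1))
        + (deriv^[4] F (y 0) * G (y 1) + 2 * (deriv (deriv F) (y 0) * deriv (deriv G) (y 1)) + F (y 0) * deriv^[4] G (y 1))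
        + (gam * Rc / (8 * Real.pi) * burgersPhi (gam * (‖y‖ ^ 2 - ⟪y, EuclideanSpace.single 2 1⟫_ℝ ^ 2) / 4)) *
            (y 1 * (deriv^[3] F (y 0) * G (y 1) + deriv F (y 0) * deriv (deriv G) (y 1))
              - y 0 * (deriv (deriv F) (y 0) * deriv G (y 1) + F (y 0) * deriv^[3] G (y 1)))
        - (gam / 2) * (gam * Rc / (4 * Real.pi) * Real.exp (-(gam * (‖y‖ ^ 2 - ⟪y, EuclideanSpace.single 2 1⟫_ℝ ^ 2) / 4))) *
            (y 0 * (F (y 0) * deriv G (y 1)) - y 1 * (deriv F (y 0) * G (y 1))) ) • EuclideanSpace.single 2 1 := by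
  -- regularity bookkeeping
  have hF2 : ContDiff ℝ 2 F := hF.of_le (by norm_num)
  have hG2 : ContDiff ℝ 2 G := hG.of_le (by norm_num)
  have hF1 : Differentiable ℝ F := hF.differentiable (by norm_num)
  have hG1 : Differentiable ℝ G := hG.differentiable (by norm_num)
  have hd2F : ContDiff ℝ 2 (deriv (deriv F)) := by
    have := hF.iterate_deriv' 2 2; simpa using this
  have hd2G : ContDiff ℝ 2 (deriv (deriv G)) := by
    have := hG.iterate_deriv' 2 2; simpa using this
  have hd1F : ContDiff ℝ 3 (deriv F) := by
    have := hF.iterate_deriv' 3 1; simpa using this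
  have hd1G : ContDiff ℝ 3 (deriv G) := by
    have := hG.iterate_deriv' 3 1; simpa using this
  have hd1F1 : Differentiable ℝ (deriv F) := hd1F.differentiable (by norm_num)
  have hd1G1 : Differentiable ℝ (deriv G) := hd1G.differentiable (by norm_num)
  have hd2F1 : Differentiable ℝ (deriv (deriv F)) := hd2F.differentiable (by norm_num)
  have hd2G1 : Differentiable ℝ (deriv (deriv G)) := hd2G.differentiable (by norm_num)
  have hd3F1 : Differentiable ℝ (deriv^[3] F) := by
    have h := hF.iterate_deriv' 1 3
    exact (by simpa using h : ContDiff ℝ 1 (deriv^[3] F)).differentiable (by norm_num)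
  have hd3G1 : Differentiable ℝ (deriv^[3] G) := by
    have h := hG.iterate_deriv' 1 3
    exact (by simpa using h : ContDiff ℝ 1 (deriv^[3] G)).differentiable (by norm_num)
  have hΨ : ContDiff ℝ 4 (fun y : EuclideanSpace ℝ (Fin 3) => F (y 0) * G (y 1)) := contDiff_sep hF hG
  have hax : ∀ z, fderiv ℝ (fun y : EuclideanSpace ℝ (Fin 3) => F (y 0) * G (y 1)) z (EuclideanSpace.single 2 1) = 0 :=
    fderiv_sep_axis hF1 hG1
  -- the scalar vorticity `w = −ΔΨ = −(F″G + FG″)` as a function, its derivative and Laplacian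
  have hw : (fun z => -(Δ (fun y : EuclideanSpace ℝ (Fin 3) => F (y 0) * G (y 1))) z) =
      fun z : EuclideanSpace ℝ (Fin 3) => (-(deriv (deriv F) (z 0))) * G (z 1) + (-(F (z 0))) * deriv (deriv G) (z 1) := by
    funext z; rw [laplacian_sep hF2 hG2 z]; ring
  have hwa : ∀ v, fderiv ℝ (fun z : EuclideanSpace ℝ (Fin 3) => (-(deriv (deriv F) (z 0))) * G (z 1)) y v =
      -(deriv^[3] F (y 0)) * G (y 1) * v 0 + (-(deriv (deriv F) (y 0))) * deriv G (y 1) * v 1 := fun v => by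
    have h := fderiv_sep_apply (F := fun t => -(deriv (deriv F) t)) ((hd2F1 (y 0)).hasDerivAt.neg) (hG1 (y 1)).hasDerivAt v
    simpa [Function.iterate_succ_apply', Function.iterate_zero] using h
  have hwb : ∀ v, fderiv ℝ (fun z : EuclideanSpace ℝ (Fin 3) => (-(F (z 0))) * deriv (deriv G) (z 1)) y v =
      -(deriv F (y 0)) * deriv (deriv G) (y 1) * v 0 + (-(F (y 0))) * deriv^[3] G (y 1) * v 1 := fun v => by
    have h := fderiv_sep_apply (F := fun t => -(F t)) (G := deriv (deriv G)) ((hF1 (y 0)).hasDerivAt.neg) (hd2G1 (y 1)).hasDerivAt v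
    simpa [Function.iterate_succ_apply', Function.iterate_zero] using h
  have hda : DifferentiableAt ℝ (fun z : EuclideanSpace ℝ (Fin 3) => (-(deriv (deriv F) (z 0))) * G (z 1)) y :=
    ((contDiff_sep hd2F.neg hG2).differentiable (by norm_num)) y
  have hdb : DifferentiableAt ℝ (fun z : EuclideanSpace ℝ (Fin 3) => (-(F (z 0))) * deriv (deriv G) (z 1)) y :=
    ((contDiff_sep hF2.neg hd2G).differentiable (by norm_num)) y
  have hDw : ∀ v, fderiv ℝ (fun z => -(Δ (fun y : EuclideanSpace ℝ (Fin 3) => F (y 0) * G (y 1))) z) y v =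
      -(deriv^[3] F (y 0)) * G (y 1) * v 0 + (-(deriv (deriv F) (y 0))) * deriv G (y 1) * v 1 +
        (-(deriv F (y 0)) * deriv (deriv G) (y 1) * v 0 + (-(F (y 0))) * deriv^[3] G (y 1) * v 1) := fun v => by
    rw [hw, fderiv_fun_add hda hdb, _root_.add_apply, hwa v, hwb v]
  have hΔw : (Δ (fun z => -(Δ (fun y : EuclideanSpace ℝ (Fin 3) => F (y 0) * G (y 1))) z)) y =
      -(deriv^[4] F (y 0)) * G (y 1) + (-(deriv (deriv F) (y 0))) * deriv (deriv G) (y 1) +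
        ((-(deriv (deriv F) (y 0))) * deriv (deriv G) (y 1) + (-(F (y 0))) * deriv^[4] G (y 1)) := by
    rw [hw]
    have hca : ContDiff ℝ 2 (fun z : EuclideanSpace ℝ (Fin 3) => (-(deriv (deriv F) (z 0))) * G (z 1)) := contDiff_sep hd2F.neg hG2
    have hcb : ContDiff ℝ 2 (fun z : EuclideanSpace ℝ (Fin 3) => (-(F (z 0))) * deriv (deriv G) (z 1)) := contDiff_sep hF2.neg hd2G
    rw [show (fun z : EuclideanSpace ℝ (Fin 3) => (-(deriv (deriv F) (z 0))) * G (z 1) + (-(F (z 0))) * deriv (deriv G) (z 1)) =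
        (fun z : EuclideanSpace ℝ (Fin 3) => (-(deriv (deriv F) (z 0))) * G (z 1)) + fun z => (-(F (z 0))) * deriv (deriv G) (z 1) from rfl,
      hca.contDiffAt.laplacian_add hcb.contDiffAt, laplacian_sep hd2F.neg hG2 y, laplacian_sep hF2.neg hd2G y]
    have e1 : deriv (deriv (fun t => -(deriv (deriv F) t))) (y 0) = -(deriv^[4] F (y 0)) := by
      simp only [deriv.fun_neg, deriv.fun_neg', Function.iterate_succ_apply', Function.iterate_zero_apply]
    have e2 : deriv (deriv (fun t => -(F t))) (y 0) = -(deriv (deriv F) (y 0)) := by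
      simp only [deriv.fun_neg, deriv.fun_neg']
    rw [e1, e2]
    simp only [Function.iterate_succ_apply', Function.iterate_zero, id]
  -- assemble
  rw [colForceVort_streamField hB2 hdivU hΨ hax y, laplacian_sep hF2 hG2 y, hDw, hDw, hΔw,
    gradient_sep (hF1 (y 0)).hasDerivAt (hG1 (y 1)).hasDerivAt, apply_of_diag hB0 hB1 hB2 y, curlCLM_of_diag hB0 hB1 hB2]
  have hS : colSwirl gam Rc (EuclideanSpace.single 2 1) y =
      (gam * Rc / (8 * Real.pi) * burgersPhi (gam * (‖y‖ ^ 2 - ⟪y, EuclideanSpace.single 2 1⟫_ℝ ^ 2) / 4)) • cross (EuclideanSpace.single 2 1) y := rfl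
  have hc0 : cross (EuclideanSpace.single (2 : Fin 3) (1:ℝ)) y 0 = -(y 1) := by simp [cross, cross_apply]
  have hc1 : cross (EuclideanSpace.single (2 : Fin 3) (1:ℝ)) y 1 = y 0 := by simp [cross, cross_apply]
  have hW : cross ((deriv F (y 0) * G (y 1)) • EuclideanSpace.single (0 : Fin 3) (1:ℝ) + (F (y 0) * deriv G (y 1)) • EuclideanSpace.single 1 1)
      (EuclideanSpace.single 2 1) =
      (F (y 0) * deriv G (y 1)) • EuclideanSpace.single 0 1 - (deriv F (y 0) * G (y 1)) • EuclideanSpace.single 1 1 := by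
    ext i; fin_cases i <;> simp [cross, cross_apply]
  rw [hS, hW]
  simp only [mul_zero, add_zero, zero_smul, sub_zero, map_zero, PiLp.add_apply, PiLp.smul_apply,
    PiLp.single_apply, smul_eq_mul, hc0, hc1, inner_sub_right, real_inner_smul_right,
    EuclideanSpace.inner_single_right, inner_sub_left]
  simp
  ring_nf

end Summit.NavierStokesRegularity.NavierStokesRegularity.Theorems.DefectColumnGate

end
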